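import Mathlib
import HarnessLib.Audit
import Summits.PneNP.PneNP.Theorems.PstarLiteralPinning

/-!
# Clamping a set of variables to zero: tools for block normalisations (ROUND-24, O1; memo g29 §83)

FRONTIER range-avoidance ladder, rung F-N3, ROUND 24 (cell `pnp-ideate`, prover-2 memo `g29/O1-SIBLINGS-g29.md` §83; census node
`PstarLocalGateBudgetAssembly.LocalMenuCriterionBoundGateBudget`; restricted-model proof complexity — nothing here bears on `P` versus `NP`).

The member-square calculus (`PstarDirtyMemberSquare`, `PstarSharedMemberSquare`, g27 §72/§74) normalises one or two private variables to `0`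
by iterated `Function.update`.  For a member whose literal `σ` carries an arbitrary finite set of siblings (`PstarMultiSiblingSquare`) the whole
family of sibling privates has to be switched off at once; this file provides the bulk operation and its bookkeeping:

* `clamp Q z` — the point `z` with every variable of the finite set `Q` set to `false`; `clamp_of_mem`, `clamp_of_not_mem`, `clamp_empty`,
  `clamp_insert` (one more variable = one more update — the induction principle), `clamp_false_of`, `clamp_update_comm` (clamping commutes with
  an update off `Q` — so a thaw pair `z, z ⊕ e_u` normalises to a thaw pair);
* `starSum_clamp_of_unpaired` — a partner sum `starSum G v` ignores a clamped set none of whose variables is `G`-paired with `v`;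
* `starSum_eq_zero_of_partners` — a partner sum all of whose partners sit at `0` vanishes.
-/

set_option linter.dupNamespace false -- `Summit.PneNP.PneNP.…`: summit = sub-problem name (D-0017 single-conjunct layout)

open Finset Literature.Computability.Complexity
open Summit.PneNP.PneNP.Theorems.PstarFibrePolys (bit)
open Summit.PneNP.PneNP.Theorems.PstarMenuLocality (starSum)

namespace Summit.PneNP.PneNP.Theorems.PstarClamp

variable {n m : ℕ}

/-! ## The clamp -/

/-- `clamp Q z`: the point `z` with every variable of `Q` set to `false`. -/
def clamp (Q : Finset (Fin n)) (z : Fin n → Bool) : Fin n → Bool := fun w => if w ∈ Q then false else z w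

/-- On `Q` the clamped point is `0`. -/
theorem clamp_of_mem {Q : Finset (Fin n)} {w : Fin n} (h : w ∈ Q) (z : Fin n → Bool) : clamp Q z w = false := by
  unfold clamp; rw [if_pos h]

/-- Off `Q` the clamped point agrees with `z`. -/
theorem clamp_of_not_mem {Q : Finset (Fin n)} {w : Fin n} (h : w ∉ Q) (z : Fin n → Bool) : clamp Q z w = z w := by
  unfold clamp; rw [if_neg h]

/-- Clamping nothing. -/
theorem clamp_empty (z : Fin n → Bool) : clamp ∅ z = z := by
  funext w; exact clamp_of_not_mem (notMem_empty w) z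

/-- Clamping one more variable is one more update. -/
theorem clamp_insert (a : Fin n) (Q : Finset (Fin n)) (z : Fin n → Bool) :
    clamp (insert a Q) z = Function.update (clamp Q z) a false := by
  funext w
  by_cases hw : w = a
  · subst hw; rw [Function.update_self, clamp_of_mem (mem_insert_self _ _)]
  · rw [Function.update_of_ne hw]
    by_cases hQ : w ∈ Q
    · rw [clamp_of_mem hQ, clamp_of_mem (mem_insert_of_mem hQ)]
    · rw [clamp_of_not_mem hQ, clamp_of_not_mem (fun h => (mem_insert.1 h).elim hw hQ)]

/-- A variable already at `0` stays at `0`. -/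
theorem clamp_false_of {Q : Finset (Fin n)} {z : Fin n → Bool} {w : Fin n} (h : z w = false) : clamp Q z w = false := by
  by_cases hQ : w ∈ Q
  · exact clamp_of_mem hQ z
  · rw [clamp_of_not_mem hQ]; exact h

/-- Clamping commutes with an update off `Q`. -/
theorem clamp_update_comm {Q : Finset (Fin n)} {u : Fin n} (hu : u ∉ Q) (z : Fin n → Bool) (b : Bool) :
    clamp Q (Function.update z u b) = Function.update (clamp Q z) u b := by
  funext w
  by_cases hw : w = u
  · subst hw; rw [Function.update_self, clamp_of_not_mem hu, Function.update_self]
  · rw [Function.update_of_ne hw]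
    by_cases hQ : w ∈ Q
    · rw [clamp_of_mem hQ, clamp_of_mem hQ]
    · rw [clamp_of_not_mem hQ, clamp_of_not_mem hQ, Function.update_of_ne hw]

/-- Flipping a variable off `Q` after clamping is clamping after flipping. -/
theorem clamp_flip_comm {Q : Finset (Fin n)} {u : Fin n} (hu : u ∉ Q) (z : Fin n → Bool) :
    Function.update (clamp Q z) u (!clamp Q z u) = clamp Q (Function.update z u (!z u)) := by
  rw [clamp_update_comm hu, clamp_of_not_mem hu]

/-! ## Partner sums -/

variable {I : LocalMap 4 n m}

/-- The partner sum of `v` does not see a clamped set none of whose variables is paired with `v`. -/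
theorem starSum_clamp_of_unpaired (G : Finset (Fin m)) {v : Fin n} {Q : Finset (Fin n)} (z : Fin n → Bool)
    (h : ∀ g ∈ G, (I.vars g 2 = v → I.vars g 3 ∉ Q) ∧ (I.vars g 3 = v → I.vars g 2 ∉ Q)) :
    starSum I G v (clamp Q z) = starSum I G v z := by
  unfold PstarMenuLocality.starSum
  refine sum_congr rfl fun g hg => ?_
  by_cases h2 : I.vars g 2 = v
  · rw [if_pos h2, if_pos h2, clamp_of_not_mem ((h g hg).1 h2)]
    by_cases h3 : I.vars g 3 = v
    · rw [if_pos h3, if_pos h3, clamp_of_not_mem ((h g hg).2 h3)]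
    · rw [if_neg h3, if_neg h3]
  · rw [if_neg h2, if_neg h2]
    by_cases h3 : I.vars g 3 = v
    · rw [if_pos h3, if_pos h3, clamp_of_not_mem ((h g hg).2 h3)]
    · rw [if_neg h3, if_neg h3]

/-- A partner sum all of whose partners sit at `0` vanishes. -/
theorem starSum_eq_zero_of_partners {G : Finset (Fin m)} {v : Fin n} (z : Fin n → Bool)
    (h : ∀ g ∈ G, (I.vars g 2 = v → z (I.vars g 3) = false) ∧ (I.vars g 3 = v → z (I.vars g 2) = false)) :
    starSum I G v z = 0 := by
  unfold PstarMenuLocality.starSum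
  refine sum_eq_zero fun g hg => ?_
  have hb : bit false = 0 := by simp [bit]
  by_cases h2 : I.vars g 2 = v
  · rw [if_pos h2, (h g hg).1 h2, hb, zero_add]
    by_cases h3 : I.vars g 3 = v
    · rw [if_pos h3, (h g hg).2 h3, hb]
    · rw [if_neg h3]
  · rw [if_neg h2, zero_add]
    by_cases h3 : I.vars g 3 = v
    · rw [if_pos h3, (h g hg).2 h3, hb]
    · rw [if_neg h3]

end Summit.PneNP.PneNP.Theorems.PstarClamp
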